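import Summits.AtomisticToContinuum.FouriersLaw.Theorems.BondHeatUncertaintyExtensiveSnapshotIrreversibilityEnergyWindowSkeletonArrivalIntegrability

/-!
# Energy window, part W-3 — the ARRIVAL GLUE:
(SWM) → (JMˣ)₂ → (I-s2)ₛ → `PerturbedKernelMomentumIBPCompact` (G1*ᶜᶜ), with (JMˣ)₁ PROVED

Lineage `stmt-AtomisticToContinuum-9121` (`ExtensiveSnapshotIrreversibility`), K_fix half, leaf S3;
cell decomp-a2c, lens «grading / quantitative ladder», generation 81, part W «Glues», file 3.
THE GLUE (critic row 1128 (d)): for `g ∈ C¹_c` with `|g| ≤ M e^{θ₁H}` and `0 < θ₁ < θ₂ < 1/T`,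
`|∫ ∂_{p_b} g dP^δ_s(z,·)| ≤ C s^{-b₀} M e^{θ₂ H(z)}` for `|δ| < δ₀`, from
* (SWM) `SkeletonWeightMoments` (arrival clause, `q`-th moments of the regularised skeleton
  weight, `∀ κ ∃ m₁`), the ONE open leaf;
* (JMˣ)₂ `SkeletonSecondVariationMoments` (T-a1 decl; proved in the seat file V-c, carried as a
  hypothesis until it lands) and (JMˣ)₁ `skeletonJacobianMoments` (T-a2, PROVED, used silently);
* (I-s2)ₛ `SkeletonEventualSurjectivity` (W-0): eventual surjectivity of the skeleton derivative.
Mechanism (memo NODE-g79 §4 (U1)–(U3), NODE-g80 §1): at level `m` and regularisation `κ_n = 1/(n+1)`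
the arrival identity (T-b3 `integral_mul_skelWeightArr_eq`; its four `L¹` conditions are W-2) reads
`E[∂_b g(X)] = E[g(X) w_{m,κ_n}] + κ_n E[Dg(X) a♯]`; Hölder with `p = 1/a`, `q = 1/(1−a)`,
`a = (1 + θ₁T*)/2` (so `pθ₁ < 1/max(T_L,T_R)` and `q ≥ 2`) bounds the first term by
`‖g(X)‖_p ‖w‖_q ≤ M e^{γ p θ₁ 2T/p} e^{θ₁H(z)} · |C| s^{-b₀} e^{(θ₂−θ₁)H(z)}` (CEHR (3.4)
`pinnedChain_lintegral_exp_hamiltonian_solMap_le` and (SWM) with `ε = θ₂ − θ₁`), and the defect by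
`L E√D_n → 0` (W-0 `exists_lintegral_sqrt_defectSq_le`, level `m ≥ n` free) — the left side does
not depend on `(n, m)` (`pinnedChain_solMap_eq_skelFlowMapAt`), so `n → ∞` last.
Main results: `abs_integral_mul_le_of_holder` (generic Hölder step), `abs_integral_partialP_comp_le`
(path level, general baths in `[T/2, 2T]`), ★ `perturbedKernelMomentumIBPCompact_of_skeleton`.
No instance / notation / option; no proof holes.
References: N. Cuneo, J.-P. Eckmann, M. Hairer, L. Rey-Bellet, Electron. J. Probab. 23 (2018), §3
eq. (3.4) [cite: CuneoEckmannHairerReyBellet2018, §3 eq. (3.4)]; D. Nualart, The Malliavin Calculus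
and Related Topics (2006), Prop. 1.3.1, §2.1.4 [cite: Nualart2006, Prop 1.3.1]. [folklore]

**File 1 of 2** (split for the 400-line cap): this file holds §1 (Hölder step) and §2 up to the defect-term estimates; the sequel module `…BondHeatUncertaintyExtensiveSnapshotIrreversibilityEnergyWindowArrivalGlue` continues in the same namespace (all declaration names unchanged).
-/

noncomputable section

namespace Summit.AtomisticToContinuum.FouriersLaw.Theorems.ExtensiveSnapshotIrreversibility.EnergyWindow

open MeasureTheory ProbabilityTheory Filter Topology Set
open scoped ENNReal NNReal Matrix ContDiff
open Literature.MathematicalPhysics.KineticTheory.HeatConduction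
open Literature.MathematicalPhysics.KineticTheory
open Literature.Probability.Process

/-! ## 1. Generic Hölder step: `|∫ G W| ≤ ‖G‖_p ‖W‖_q` with the moment bounds plugged in -/

/-- `|∫ G W dμ| ≤ A₁ A₂` when `∫ |G|^p ≤ A₁^p`, `∫ |W|^q ≤ A₂^q`, `1/p + 1/q = 1`. [folklore] -/
theorem abs_integral_mul_le_of_holder {α : Type*} [MeasurableSpace α] (μ : Measure α) {p q : ℝ}
    (hpq : p.HolderConjugate q) {G W : α → ℝ} (hG : Measurable G) (hW : Measurable W)
    {A₁ A₂ : ℝ} (hA₁ : 0 ≤ A₁) (hA₂ : 0 ≤ A₂)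
    (h1 : ∫⁻ a, ENNReal.ofReal |G a| ^ p ∂μ ≤ ENNReal.ofReal (A₁ ^ p))
    (h2 : ∫⁻ a, ENNReal.ofReal |W a| ^ q ∂μ ≤ ENNReal.ofReal (A₂ ^ q)) :
    |∫ a, G a * W a ∂μ| ≤ A₁ * A₂ := by
  have hf : Measurable fun a => ENNReal.ofReal |G a| :=
    (continuous_abs.measurable.comp hG).ennreal_ofReal
  have hg : Measurable fun a => ENNReal.ofReal |W a| :=
    (continuous_abs.measurable.comp hW).ennreal_ofReal
  have hH := ENNReal.lintegral_mul_le_Lp_mul_Lq μ hpq hf.aemeasurable hg.aemeasurable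
  have h1' : (∫⁻ a, ENNReal.ofReal |G a| ^ p ∂μ) ^ (1 / p) ≤ ENNReal.ofReal A₁ := by
    calc _ ≤ (ENNReal.ofReal (A₁ ^ p)) ^ (1 / p) := ENNReal.rpow_le_rpow h1 hpq.one_div_nonneg
      _ = ENNReal.ofReal A₁ := by
          rw [← ENNReal.ofReal_rpow_of_nonneg hA₁ hpq.nonneg, one_div,
            ENNReal.rpow_rpow_inv hpq.ne_zero]
  have h2' : (∫⁻ a, ENNReal.ofReal |W a| ^ q ∂μ) ^ (1 / q) ≤ ENNReal.ofReal A₂ := by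
    calc _ ≤ (ENNReal.ofReal (A₂ ^ q)) ^ (1 / q) := ENNReal.rpow_le_rpow h2 hpq.symm.one_div_nonneg
      _ = ENNReal.ofReal A₂ := by
          rw [← ENNReal.ofReal_rpow_of_nonneg hA₂ hpq.symm.nonneg, one_div,
            ENNReal.rpow_rpow_inv hpq.symm.ne_zero]
  have hprod : ∫⁻ a, ENNReal.ofReal ‖G a * W a‖ ∂μ ≤ ENNReal.ofReal (A₁ * A₂) := by
    calc ∫⁻ a, ENNReal.ofReal ‖G a * W a‖ ∂μ
        = ∫⁻ a, ((fun a => ENNReal.ofReal |G a|) * fun a => ENNReal.ofReal |W a|) a ∂μ := by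
          refine lintegral_congr fun a => ?_
          rw [Real.norm_eq_abs, abs_mul, ENNReal.ofReal_mul (abs_nonneg _)]
          rfl
      _ ≤ _ := hH
      _ ≤ ENNReal.ofReal A₁ * ENNReal.ofReal A₂ := mul_le_mul' h1' h2'
      _ = ENNReal.ofReal (A₁ * A₂) := (ENNReal.ofReal_mul hA₁).symm
  calc |∫ a, G a * W a ∂μ| = ‖∫ a, G a * W a ∂μ‖ := (Real.norm_eq_abs _).symm
    _ ≤ (∫⁻ a, ENNReal.ofReal ‖G a * W a‖ ∂μ).toReal := norm_integral_le_lintegral_norm _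
    _ ≤ (ENNReal.ofReal (A₁ * A₂)).toReal := ENNReal.toReal_mono ENNReal.ofReal_ne_top hprod
    _ = A₁ * A₂ := ENNReal.toReal_ofReal (mul_nonneg hA₁ hA₂)

/-- `x^q ≤ |x|^q` packaged for the (SWM) constant: the bound with `C` implies the bound with `|C|`.
[folklore] -/
theorem ofReal_rpow_le_ofReal_abs_rpow (C u : ℝ) (hu : 0 < u) (q : ℝ) :
    ENNReal.ofReal ((C * u) ^ q) ≤ ENNReal.ofReal ((|C| * u) ^ q) := by
  refine ENNReal.ofReal_le_ofReal ?_
  calc (C * u) ^ q ≤ |(C * u) ^ q| := le_abs_self _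
    _ ≤ |C * u| ^ q := Real.abs_rpow_le_abs_rpow _ _
    _ = (|C| * u) ^ q := by rw [abs_mul, abs_of_pos hu]

/-! ## 2. The path-level estimates -/

section Arrival

variable {ω₂ lam β γ : ℝ} (hω : 0 < ω₂) (hl : 0 < lam) (hβ : 0 < β) (hγ : 0 < γ) {N : ℕ}
  (hN : 0 < N) {T T_L T_R : ℝ} (hT : 0 < T) (hTL : T / 2 ≤ T_L) (hTL' : T_L ≤ 2 * T)
  (hTR : T / 2 ≤ T_R) (hTR' : T_R ≤ 2 * T)

include hω hl hβ hγ hN in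
/-- **`‖g(X)‖_p^p` by CEHR (3.4)**: for `|g| ≤ M e^{θ₁H}` and `pθ₁ < 1/max(T_L,T_R)`, at every
level `m` and `s ∈ [0, 1]`,
`E|g(E_m)|^p ≤ (M e^{pθ₁γ(T_L+T_R)/p} e^{θ₁H(z)})^p`.
[cite: CuneoEckmannHairerReyBellet2018, §3 eq. (3.4)] -/
theorem lintegral_rpow_abs_comp_skelFlowMapAt_le (hTL0 : 0 < T_L) (hTR0 : 0 < T_R) {θ₁ p : ℝ}
    (hθ₁ : 0 < θ₁) (hp : 0 < p) (hpθ : p * θ₁ < 1 / max T_L T_R) {s : ℝ} (hs : s ∈ Icc (0 : ℝ) 1)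
    (m : ℕ) (z : PhaseSpace N) {g : PhaseSpace N → ℝ} {M : ℝ} (hM : 0 ≤ M)
    (hgM : ∀ w, |g w| ≤ M * Real.exp (θ₁ * (pinnedChain ω₂ lam β γ).hamiltonian N w)) :
    ∫⁻ wp, ENNReal.ofReal |g (skelFlowMapAt ω₂ lam β γ N T_L T_R s m z (pairRem m wp)
        (pairSkel m wp))| ^ p ∂wienerPair ≤
      ENNReal.ofReal ((M * Real.exp (p * θ₁ * γ * (T_L + T_R)) ^ p⁻¹ *
        Real.exp (θ₁ * (pinnedChain ω₂ lam β γ).hamiltonian N z)) ^ p) := by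
  have hpt : ∀ w, ENNReal.ofReal |g w| ^ p ≤ ENNReal.ofReal (M ^ p) *
      ENNReal.ofReal (Real.exp (p * θ₁ * (pinnedChain ω₂ lam β γ).hamiltonian N w)) := by
    intro w
    rw [ENNReal.ofReal_rpow_of_nonneg (abs_nonneg _) hp.le, ← ENNReal.ofReal_mul (Real.rpow_nonneg hM _)]
    refine ENNReal.ofReal_le_ofReal ?_
    calc |g w| ^ p ≤ (M * Real.exp (θ₁ * (pinnedChain ω₂ lam β γ).hamiltonian N w)) ^ p :=
          Real.rpow_le_rpow (abs_nonneg _) (hgM w) hp.le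
      _ = M ^ p * Real.exp (p * θ₁ * (pinnedChain ω₂ lam β γ).hamiltonian N w) := by
          rw [Real.mul_rpow hM (Real.exp_pos _).le, ← Real.exp_mul]
          congr 2
          ring
  have hce := pinnedChain_lintegral_exp_hamiltonian_solMap_le hω hl.le hβ.le hγ.le hN hTL0 hTR0
    (mul_pos hp hθ₁) hpθ ⟨s, hs.1⟩ z
  have hX0 : 0 ≤ p * θ₁ * γ * (T_L + T_R) :=
    mul_nonneg (mul_nonneg (mul_nonneg hp.le hθ₁.le) hγ.le) (add_nonneg hTL0.le hTR0.le)
  calc ∫⁻ wp, ENNReal.ofReal |g (skelFlowMapAt ω₂ lam β γ N T_L T_R s m z (pairRem m wp)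
        (pairSkel m wp))| ^ p ∂wienerPair
      ≤ ∫⁻ wp, ENNReal.ofReal (M ^ p) * ENNReal.ofReal (Real.exp (p * θ₁ *
          (pinnedChain ω₂ lam β γ).hamiltonian N (skelFlowMapAt ω₂ lam β γ N T_L T_R s m z
            (pairRem m wp) (pairSkel m wp)))) ∂wienerPair := lintegral_mono fun wp => hpt _
    _ = ENNReal.ofReal (M ^ p) * ∫⁻ wp, ENNReal.ofReal (Real.exp (p * θ₁ *
          (pinnedChain ω₂ lam β γ).hamiltonian N ((pinnedChain ω₂ lam β γ).solMap N T_L T_R s z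
            (pairPath wp)))) ∂wienerPair := by
        rw [lintegral_const_mul' _ _ ENNReal.ofReal_ne_top]
        congr 1
        refine lintegral_congr fun wp => ?_
        rw [pinnedChain_solMap_eq_skelFlowMapAt hω hl.le hβ.le hγ.le N T_L T_R hs m z wp]
    _ ≤ ENNReal.ofReal (M ^ p) * ENNReal.ofReal (Real.exp (p * θ₁ * γ * (T_L + T_R) * s) *
          Real.exp (p * θ₁ * (pinnedChain ω₂ lam β γ).hamiltonian N z)) :=
        mul_le_mul_right hce _
    _ ≤ ENNReal.ofReal (M ^ p) * ENNReal.ofReal (Real.exp (p * θ₁ * γ * (T_L + T_R)) *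
          Real.exp (p * θ₁ * (pinnedChain ω₂ lam β γ).hamiltonian N z)) :=
        mul_le_mul_right (ENNReal.ofReal_le_ofReal (mul_le_mul_of_nonneg_right
          (Real.exp_le_exp.2 (mul_le_of_le_one_right hX0 hs.2)) (Real.exp_pos _).le)) _
    _ = ENNReal.ofReal ((M * Real.exp (p * θ₁ * γ * (T_L + T_R)) ^ p⁻¹ *
          Real.exp (θ₁ * (pinnedChain ω₂ lam β γ).hamiltonian N z)) ^ p) := by
        rw [← ENNReal.ofReal_mul (Real.rpow_nonneg hM _)]
        congr 1
        rw [Real.mul_rpow (mul_nonneg hM (Real.rpow_nonneg (Real.exp_pos _).le _))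
          (Real.exp_pos _).le, Real.mul_rpow hM (Real.rpow_nonneg (Real.exp_pos _).le _),
          Real.rpow_inv_rpow (Real.exp_pos _).le hp.ne', ← Real.exp_mul]
        have h3 : θ₁ * (pinnedChain ω₂ lam β γ).hamiltonian N z * p =
            p * θ₁ * (pinnedChain ω₂ lam β γ).hamiltonian N z := by ring
        rw [h3]
        ring

include hω hl hβ hγ in
/-- The regularised arrival weight along the path is measurable. [folklore] -/
theorem measurable_skelWeightArr_path {s : ℝ} (hs : s ∈ Icc (0 : ℝ) 1) (m : ℕ) {κ : ℝ}
    (hκ : 0 < κ) (b : Fin N) (z : PhaseSpace N) :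
    Measurable fun wp : WienerPair =>
      skelWeightArr ω₂ lam β γ N T_L T_R s m κ b z (pairRem m wp) (pairSkel m wp) := by
  have h1 : ∀ j, Measurable fun wp : WienerPair => coordX m (pairSkel m wp) j *
      skelFieldArr ω₂ lam β γ N T_L T_R s m κ b z (pairRem m wp) (pairSkel m wp) j := fun j =>
    ((measurable_coordX m j).comp (measurable_pairSkel m)).mul
      (measurable_skelFieldArr_path hω hl hβ hγ hs m κ b z j)
  have h2 : ∀ j, Measurable fun wp : WienerPair => fderiv ℝ (fun y =>
      skelFieldArr ω₂ lam β γ N T_L T_R s m κ b z (pairRem m wp) y j) (pairSkel m wp)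
        (basisX m j) := fun j =>
    measurable_fderiv_skelFieldArr_path hω hl hβ hγ hs m hκ b z j (basisX m j)
  have h := (Finset.measurable_sum Finset.univ fun j _ => h1 j).sub
    ((Finset.measurable_sum Finset.univ fun j _ => h2 j).const_mul (((2 : ℝ) ^ m)⁻¹))
  exact h

include hω hl hβ hγ in
/-- `∂_{p_b} g ∘ E` is integrable for `g ∈ C¹` with bounded derivative. [folklore] -/
theorem integrable_partialP_comp_path (s : ℝ) (m : ℕ) (b : Fin N) (z : PhaseSpace N)
    {g : PhaseSpace N → ℝ} (hg : ContDiff ℝ 1 g) {L : ℝ}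
    (hgL : ∀ w v, |fderiv ℝ g w v| ≤ L * ‖v‖) :
    Integrable (fun wp : WienerPair =>
      partialP b g (skelFlowMapAt ω₂ lam β γ N T_L T_R s m z (pairRem m wp) (pairSkel m wp)))
      wienerPair :=
  Integrable.mono' (integrable_const (L * ‖(((0 : Fin N → ℝ), Pi.single b 1) : PhaseSpace N)‖))
    (measurable_comp_skelFlowMapAt_path hω hl hβ hγ s m z
      (continuous_partialP_of_contDiff b hg)).aestronglyMeasurable
    (Eventually.of_forall fun wp => by
      rw [Real.norm_eq_abs, partialP_eq_fderiv_apply b ((hg.differentiable one_ne_zero) _)]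
      exact hgL _ _)

include hω hl hβ hγ in
/-- **Pointwise size of the defect term** (level `m ≥ n`, `κ_n = 1/(n+1)`):
`|κ_n Dg(E) a♯| ≤ L √D_n` (W-0 `mul_norm_ofCoordV_regInv_le_sqrt_defectSq`). [folklore] -/
theorem norm_defectTerm_le {s : ℝ} (hs : s ∈ Icc (0 : ℝ) 1) (z : PhaseSpace N) (b : Fin N)
    {g : PhaseSpace N → ℝ} {L : ℝ} (hL : 0 ≤ L) (hgL : ∀ w v, |fderiv ℝ g w v| ≤ L * ‖v‖)
    {n m : ℕ} (hnm : n ≤ m) (wp : WienerPair) :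
    ‖((n : ℝ) + 1)⁻¹ * fderiv ℝ g (skelFlowMapAt ω₂ lam β γ N T_L T_R s m z (pairRem m wp)
        (pairSkel m wp)) (ofCoordV N (skelCtrlArr ω₂ lam β γ N T_L T_R s m ((n : ℝ) + 1)⁻¹ b z
          (pairRem m wp) (pairSkel m wp)))‖ ≤
      L * √(defectSq ω₂ lam β γ N T_L T_R s z (fun _ => momCoord N b) n wp) := by
  rw [Real.norm_eq_abs, abs_mul, abs_of_pos (inv_natCast_succ_pos n)]
  have h1 := hgL (skelFlowMapAt ω₂ lam β γ N T_L T_R s m z (pairRem m wp) (pairSkel m wp))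
    (ofCoordV N (skelCtrlArr ω₂ lam β γ N T_L T_R s m ((n : ℝ) + 1)⁻¹ b z (pairRem m wp)
      (pairSkel m wp)))
  have h2 : ((n : ℝ) + 1)⁻¹ * ‖ofCoordV N (skelCtrlArr ω₂ lam β γ N T_L T_R s m ((n : ℝ) + 1)⁻¹ b z
      (pairRem m wp) (pairSkel m wp))‖ ≤
      √(defectSq ω₂ lam β γ N T_L T_R s z (fun _ => momCoord N b) n wp) :=
    mul_norm_ofCoordV_regInv_le_sqrt_defectSq hω hl.le hβ.le hγ.le N T_L T_R hs z
      (fun _ => momCoord N b) hnm wp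
  calc ((n : ℝ) + 1)⁻¹ * |fderiv ℝ g (skelFlowMapAt ω₂ lam β γ N T_L T_R s m z (pairRem m wp)
        (pairSkel m wp)) (ofCoordV N (skelCtrlArr ω₂ lam β γ N T_L T_R s m ((n : ℝ) + 1)⁻¹ b z
          (pairRem m wp) (pairSkel m wp)))|
      ≤ ((n : ℝ) + 1)⁻¹ * (L * ‖ofCoordV N (skelCtrlArr ω₂ lam β γ N T_L T_R s m ((n : ℝ) + 1)⁻¹
          b z (pairRem m wp) (pairSkel m wp))‖) :=
        mul_le_mul_of_nonneg_left h1 (inv_natCast_succ_pos n).le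
    _ = L * (((n : ℝ) + 1)⁻¹ * ‖ofCoordV N (skelCtrlArr ω₂ lam β γ N T_L T_R s m ((n : ℝ) + 1)⁻¹
          b z (pairRem m wp) (pairSkel m wp))‖) := by ring
    _ ≤ _ := mul_le_mul_of_nonneg_left h2 hL

include hω hl hβ hγ in
/-- The defect term is measurable along the path (`g ∈ C¹`). [folklore] -/
theorem measurable_defectTerm {s : ℝ} (hs : s ∈ Icc (0 : ℝ) 1) (m : ℕ) (κ : ℝ) (b : Fin N)
    (z : PhaseSpace N) {g : PhaseSpace N → ℝ} (hg : ContDiff ℝ 1 g) :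
    Measurable fun wp : WienerPair => κ * fderiv ℝ g (skelFlowMapAt ω₂ lam β γ N T_L T_R s m z
      (pairRem m wp) (pairSkel m wp)) (ofCoordV N (skelCtrlArr ω₂ lam β γ N T_L T_R s m κ b z
        (pairRem m wp) (pairSkel m wp))) := by
  have hc : ∀ a, Measurable fun wp : WienerPair =>
      skelCtrlArr ω₂ lam β γ N T_L T_R s m κ b z (pairRem m wp) (pairSkel m wp) a := fun a => by
    have h := (measurable_skelCtrlArr_apply hω hl.le hβ.le hγ.le N T_L T_R hs m κ b z a).comp
      (measurable_pairSkel_prodMk_pairRem m)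
    exact h
  have hv : Measurable fun wp : WienerPair =>
      ofCoordV N (skelCtrlArr ω₂ lam β γ N T_L T_R s m κ b z (pairRem m wp) (pairSkel m wp)) :=
    (measurable_pi_lambda _ fun i => hc (Sum.inl i)).prodMk
      (measurable_pi_lambda _ fun i => hc (Sum.inr i))
  have hE : Measurable fun wp : WienerPair =>
      skelFlowMapAt ω₂ lam β γ N T_L T_R s m z (pairRem m wp) (pairSkel m wp) := by
    have h := (measurable_skelFlowMapAt hω hl.le hβ.le hγ.le N T_L T_R s m z).comp
      (measurable_pairSkel_prodMk_pairRem m)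
    exact h
  have hcont : Continuous fun p : PhaseSpace N × PhaseSpace N => fderiv ℝ g p.1 p.2 :=
    ((hg.continuous_fderiv one_ne_zero).comp continuous_fst).clm_apply continuous_snd
  have h := (hcont.measurable.comp (hE.prodMk hv)).const_mul κ
  exact h

include hω hl hβ hγ in
/-- The defect term is integrable (bounded by `L |e_b|`). [folklore] -/
theorem integrable_defectTerm {s : ℝ} (hs : s ∈ Icc (0 : ℝ) 1) (z : PhaseSpace N) (b : Fin N)
    {g : PhaseSpace N → ℝ} (hg : ContDiff ℝ 1 g) {L : ℝ} (hL : 0 ≤ L)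
    (hgL : ∀ w v, |fderiv ℝ g w v| ≤ L * ‖v‖) {n m : ℕ} (hnm : n ≤ m) :
    Integrable (fun wp : WienerPair => ((n : ℝ) + 1)⁻¹ * fderiv ℝ g
      (skelFlowMapAt ω₂ lam β γ N T_L T_R s m z (pairRem m wp) (pairSkel m wp))
        (ofCoordV N (skelCtrlArr ω₂ lam β γ N T_L T_R s m ((n : ℝ) + 1)⁻¹ b z (pairRem m wp)
          (pairSkel m wp)))) wienerPair :=
  Integrable.mono' (integrable_const (L * √(momCoord N b ⬝ᵥ momCoord N b)))
    (measurable_defectTerm hω hl hβ hγ hs m _ b z hg).aestronglyMeasurable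
    (Eventually.of_forall fun wp =>
      (norm_defectTerm_le hω hl hβ hγ hs z b hL hgL hnm wp).trans
        (mul_le_mul_of_nonneg_left (Real.sqrt_le_sqrt
          (defectSq_le_dotProduct N T_L T_R s z (fun _ => momCoord N b) n wp)) hL))

include hω hl hβ hγ in
/-- **The defect integral is `≤ L η`** once `E√D_n ≤ η` (level `m ≥ n`). [folklore] -/
theorem abs_integral_defectTerm_le {s : ℝ} (hs : s ∈ Icc (0 : ℝ) 1) (m : ℕ) (z : PhaseSpace N)
    (b : Fin N) {g : PhaseSpace N → ℝ} {L : ℝ} (hL : 0 ≤ L)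
    (hgL : ∀ w v, |fderiv ℝ g w v| ≤ L * ‖v‖) {n : ℕ} (hnm : n ≤ m) {η : ℝ} (hη : 0 ≤ η)
    (hD : ∫⁻ wp, ENNReal.ofReal
        (√(defectSq ω₂ lam β γ N T_L T_R s z (fun _ => momCoord N b) n wp)) ∂wienerPair ≤
      ENNReal.ofReal η) :
    |∫ wp, ((n : ℝ) + 1)⁻¹ * fderiv ℝ g (skelFlowMapAt ω₂ lam β γ N T_L T_R s m z (pairRem m wp)
        (pairSkel m wp)) (ofCoordV N (skelCtrlArr ω₂ lam β γ N T_L T_R s m ((n : ℝ) + 1)⁻¹ b z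
          (pairRem m wp) (pairSkel m wp))) ∂wienerPair| ≤ L * η := by
  have hint : ∫⁻ wp, ENNReal.ofReal ‖((n : ℝ) + 1)⁻¹ * fderiv ℝ g
      (skelFlowMapAt ω₂ lam β γ N T_L T_R s m z (pairRem m wp) (pairSkel m wp))
        (ofCoordV N (skelCtrlArr ω₂ lam β γ N T_L T_R s m ((n : ℝ) + 1)⁻¹ b z (pairRem m wp)
          (pairSkel m wp)))‖ ∂wienerPair ≤ ENNReal.ofReal L * ENNReal.ofReal η := by
    calc _ ≤ ∫⁻ wp, ENNReal.ofReal (L *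
          √(defectSq ω₂ lam β γ N T_L T_R s z (fun _ => momCoord N b) n wp)) ∂wienerPair :=
          lintegral_mono fun wp => ENNReal.ofReal_le_ofReal
            (norm_defectTerm_le hω hl hβ hγ hs z b hL hgL hnm wp)
      _ = ENNReal.ofReal L * ∫⁻ wp, ENNReal.ofReal
          (√(defectSq ω₂ lam β γ N T_L T_R s z (fun _ => momCoord N b) n wp)) ∂wienerPair := by
          rw [← lintegral_const_mul' _ _ ENNReal.ofReal_ne_top]
          refine lintegral_congr fun wp => ?_
          rw [ENNReal.ofReal_mul hL]
      _ ≤ ENNReal.ofReal L * ENNReal.ofReal η := mul_le_mul_right hD _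
  calc _ = ‖∫ wp, ((n : ℝ) + 1)⁻¹ * fderiv ℝ g (skelFlowMapAt ω₂ lam β γ N T_L T_R s m z
        (pairRem m wp) (pairSkel m wp)) (ofCoordV N (skelCtrlArr ω₂ lam β γ N T_L T_R s m
          ((n : ℝ) + 1)⁻¹ b z (pairRem m wp) (pairSkel m wp))) ∂wienerPair‖ :=
        (Real.norm_eq_abs _).symm
    _ ≤ _ := norm_integral_le_lintegral_norm _
    _ ≤ (ENNReal.ofReal L * ENNReal.ofReal η).toReal :=
        ENNReal.toReal_mono (ENNReal.mul_ne_top ENNReal.ofReal_ne_top ENNReal.ofReal_ne_top) hint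
    _ = L * η := by rw [ENNReal.toReal_mul, ENNReal.toReal_ofReal hL, ENNReal.toReal_ofReal hη]

end Arrival

end Summit.AtomisticToContinuum.FouriersLaw.Theorems.ExtensiveSnapshotIrreversibility.EnergyWindow

end
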